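import Summits.ValiantsHypothesis.ValiantsHypothesis.Theorems.GeneratorObstructionsPerGenDegreeSuperQPExtremalRays

/-!
# Route GeneratorObstructions — K1 `PerGenDegreeSuperQP` (stmt-ValiantsHypothesis-11654),
# line `per-side-atoms`: FACE LAYERS of the occurrence monoid start with an atom
# (block-pattern faces; fattened rectangular directions; `stub_atomLate` ⇐ a late layer)

Support file of the line (companions `…AtomCertificates`, `…RectangularAtom`, `…AtomsGenerate`,
`…MinimalDegree`, `…RectangularRays`, `…ExtremalRays`, `…RayCriterion`, …).

`…RectangularRays` / `…ExtremalRays` proved: a face of the occurrence monoid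
`S(f) = {χ : HWV_χ(ℂ[Δ_n[f]]) ≠ ⊥}` that lies in a RAY starts with an atom. This file removes the
restriction to rays. The occurrence monoid is graded by the degree `-|χ|/n > 0` of its nonzero
elements, and this grading peels faces layer by layer:

1. `atom_of_minDegree_layer` — **face layers start with an atom.** Let `P` be FACIAL for `S(f)`
   (`P (χ₁ + χ₂) → P χ₁ ∧ P χ₂` for occurring `χ₁, χ₂`) and `R ⊆ P` ADDITIVE on occurring
   weights (a sub-face, or just a submonoid). Then an occurring weight with `P ∧ ¬R` of LEAST
   DEGREE among all occurring weights with `P ∧ ¬R` is an ATOM of `S(f)`: a splitting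
   `χ = χ₁ + χ₂` into nonzero occurring weights has both `χᵢ` in the face, not both in `R`, and
   the one outside `R` has smaller degree. `exists_atom_of_layer` packages existence of the
   least-degree element (degrees are natural numbers).
2. `isBlockConstant_of_isDominant_add` — for ANY labelling `κ : σ → β` of the indices, the
   property "`χ` is constant on every block `κ⁻¹(b)`" is facial for dominant weights (two
   antitone functions whose sum is constant on a set are each constant on it), and "constant"
   (one block) is additive. Hence `exists_atom_of_blockLayer`: **if some occurring weight is
   `κ`-block-constant but not constant, the least-degree such weight is an atom.** The faces of
   the dominant chamber are exactly the block patterns of interval labellings; for the TWO-block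
   labelling `a ↦ (a ≤ p)` (`j = #{a ≤ p}`) the layer consists of the "fattened rectangles"
   `-(t·𝟙 + k·𝟙_{a > p})`, `k ≥ 1, t ≥ 0` — the pure chamber ray `(k^{m²-j})^*`-direction of
   `…RectangularRays` is its `t = 0` edge — and its first point is an atom whether or not the
   pure ray is ever hit (`per_exists_atom_of_fatLayer`).
3. `stub_atomLate_of_late_blockLayer` / `stub_atomLate_of_late_fatLayer` — the registered
   `stub_atomLate` VERBATIM from: for every `c` and infinitely many `m` some block layer (resp.
   some two-block layer) of `S(per_m)` is populated and every weight in it has degree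
   `> 2^((log₂ m + c)^c)`.

Why the two-block layers matter (informal; NOT used in the proofs). Along the closed
`SL_{m²}`-orbit of `per_m` (the permanent is polystable) the functor `V ↦ V^U_λ` is exact, so
`A(Δ(per_m)) = ℂ[Δ(per_m)]^U` surjects onto `ℂ[SL_{m²}·per_m]^U`, whose weight monoid is the
orbit monoid `S° = {λ : V_λ^{H'} ≠ 0}`, `H' = Stab_{SL}(per_m) = T^{2m-2}·((S_m × S_m) ⋊ 2)`;
restriction `χ ↦ χ mod ℤ𝟙` maps `S(per_m)` ONTO `S°`. Every fundamental direction of `S°` is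
hit in level `≤ 2m²` (a product of `m²` translated Plücker coordinates, squared and
symmetrised over the finite part of `H'`, is a nonzero `H'`-invariant), so EVERY two-block layer
of `S(per_m)` is populated, with `k ≤ 2m²` available; all atoms of `S°` have polynomial level.
Consequently a late two-block atom — indeed any late atom of `S(per_m)` — is late only through
its FATTENING `t`, i.e. through the least degree in which a fixed orbit type first occurs in the
coordinate ring of the orbit CLOSURE: lateness of atoms is an orbit-closure (first-occurrence)
phenomenon, invisible to the stabiliser's invariant theory. This is recorded in the evidence memo
of this session; the Lean content below is items 1–3 only.

Honest framing: structure lemmas and conditional reductions; `stub_atomLate` (for `c ≥ 2`), K1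
and `GenFlipThesis` remain OPEN; nothing here bears on VP versus VNP.
References: [BurgisserHuttenhainIkenmeyer2017] §1–2 (monoid of representations of an orbit
closure, orbit versus closure); [BurgisserEtAl2011] §5.3; [BurgisserIkenmeyer2017] Prop. 2.8,
§3.3 (polystability of `per_m`, minimal degrees) as background only.
-/

set_option linter.dupNamespace false

noncomputable section

namespace Summit.ValiantsHypothesis.ValiantsHypothesis.Theorems.GeneratorObstructions.PerGenDegreeSuperQP

open MvPolynomial
open Literature.NumberTheory.DiophantineGeometry Literature.Computability.AlgebraicComplexity
  Literature.Computability.Complexity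

/-! ### 1. Sizes of occurring weights -/

section Sizes

variable {σ : Type*} [Fintype σ] [LinearOrder σ]

omit [LinearOrder σ] in
/-- The size of a sum of weights is the sum of the sizes. [folklore] -/
theorem size_add_eq (χ ψ : Weight σ) : (χ + ψ).size = χ.size + ψ.size := by
  unfold Weight.size
  rw [← Finset.sum_add_distrib]
  rfl

/-- An occurring weight of `ℂ[Δ_n[f]]` has nonpositive size (its entries are `≤ 0`). [folklore] -/
theorem size_nonpos_of_occurs (f : MvPolynomial σ ℂ) (n : ℕ) {χ : Weight σ}
    (hχ : highestWeightSpace (orbitCoordRep f n) χ ≠ ⊥) : χ.size ≤ 0 := by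
  haveI : Infinite ℂ := CharZero.infinite ℂ
  obtain ⟨hle, -⟩ := nonpos_and_exists_size_eq_of_hasHighestWeight_orbitCoordRep f
    (show HasHighestWeight (orbitCoordRep f n) χ from hχ)
  exact Finset.sum_nonpos fun i _ => hle i

/-- A NONZERO occurring weight of `ℂ[Δ_n[f]]` has negative size, i.e. positive degree.
[folklore] -/
theorem size_neg_of_occurs_ne_zero (f : MvPolynomial σ ℂ) (n : ℕ) {χ : Weight σ}
    (hχ : highestWeightSpace (orbitCoordRep f n) χ ≠ ⊥) (hχ0 : χ ≠ 0) : χ.size < 0 := by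
  haveI : Infinite ℂ := CharZero.infinite ℂ
  obtain ⟨hle, -⟩ := nonpos_and_exists_size_eq_of_hasHighestWeight_orbitCoordRep f
    (show HasHighestWeight (orbitCoordRep f n) χ from hχ)
  rcases (size_nonpos_of_occurs f n hχ).lt_or_eq with h | h
  · exact h
  · exact absurd (weight_eq_zero_of_nonpos_of_size_eq_zero hle h) hχ0

end Sizes

/-! ### 2. Face layers start with an atom -/

section Layer

variable {σ : Type*} [Fintype σ] [LinearOrder σ]

/-- **Face layers start with an atom.** Let `P` be a property of weights that is FACIAL for the
occurrence monoid of `ℂ[Δ_n[f]]` (two occurring weights whose sum has `P` both have `P`) and `R`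
a property ADDITIVE on occurring weights of the face (`R χ₁ → R χ₂ → R (χ₁ + χ₂)`). If the
occurring weight `χ` has `P`, not `R`, and LEAST DEGREE among all occurring weights with `P` and
not `R` (largest size: sizes of occurring weights are `-n·degree ≤ 0`), then `χ` is an ATOM: in a
splitting `χ = χ₁ + χ₂` into nonzero occurring weights both summands lie on the face, at least one
of them is outside `R` (else `R χ`), and that one has strictly larger size than `χ` because the
other summand has negative size. (Peeling principle for faces of a positively graded monoid; the
ray case is `…ExtremalRays.exists_atom_of_face_subset_ray`.) [folklore] -/
theorem atom_of_minDegree_layer (f : MvPolynomial σ ℂ) (n : ℕ) (P R : Weight σ → Prop)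
    (hface : ∀ χ₁ χ₂ : Weight σ, highestWeightSpace (orbitCoordRep f n) χ₁ ≠ ⊥ →
      highestWeightSpace (orbitCoordRep f n) χ₂ ≠ ⊥ → P (χ₁ + χ₂) → P χ₁ ∧ P χ₂)
    (hadd : ∀ χ₁ χ₂ : Weight σ, highestWeightSpace (orbitCoordRep f n) χ₁ ≠ ⊥ →
      highestWeightSpace (orbitCoordRep f n) χ₂ ≠ ⊥ → P χ₁ → P χ₂ → R χ₁ → R χ₂ → R (χ₁ + χ₂))
    {χ : Weight σ} (hP : P χ) (hR : ¬ R χ)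
    (hmin : ∀ ψ : Weight σ, highestWeightSpace (orbitCoordRep f n) ψ ≠ ⊥ → P ψ → ¬ R ψ →
      ψ.size ≤ χ.size) :
    ∀ χ₁ χ₂ : Weight σ, χ₁ + χ₂ = χ → χ₁ ≠ 0 → χ₂ ≠ 0 →
      highestWeightSpace (orbitCoordRep f n) χ₁ = ⊥ ∨
        highestWeightSpace (orbitCoordRep f n) χ₂ = ⊥ := by
  intro χ₁ χ₂ hsum h1 h2
  by_contra hne
  rw [not_or] at hne
  obtain ⟨hne1, hne2⟩ := hne
  have hP12 : P (χ₁ + χ₂) := by rw [hsum]; exact hP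
  obtain ⟨hP1, hP2⟩ := hface χ₁ χ₂ hne1 hne2 hP12
  have hs1 := size_neg_of_occurs_ne_zero f n hne1 h1
  have hs2 := size_neg_of_occurs_ne_zero f n hne2 h2
  have hsz : χ.size = χ₁.size + χ₂.size := by rw [← hsum]; exact size_add_eq χ₁ χ₂
  by_cases hR1 : R χ₁
  · by_cases hR2 : R χ₂
    · exact hR (by rw [← hsum]; exact hadd χ₁ χ₂ hne1 hne2 hP1 hP2 hR1 hR2)
    · have := hmin χ₂ hne2 hP2 hR2
      omega
  · have := hmin χ₁ hne1 hP1 hR1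
    omega

/-- **A populated layer has a least-degree element.** If some occurring weight of `ℂ[Δ_n[f]]`
has `P` and not `R`, then some occurring weight with `P` and not `R` has least degree (largest
size) among all of them — sizes of occurring weights are nonpositive integers. [folklore] -/
theorem exists_minDegree_of_layer (f : MvPolynomial σ ℂ) (n : ℕ) (P R : Weight σ → Prop)
    (hex : ∃ χ : Weight σ, highestWeightSpace (orbitCoordRep f n) χ ≠ ⊥ ∧ P χ ∧ ¬ R χ) :
    ∃ χ : Weight σ, highestWeightSpace (orbitCoordRep f n) χ ≠ ⊥ ∧ P χ ∧ ¬ R χ ∧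
      ∀ ψ : Weight σ, highestWeightSpace (orbitCoordRep f n) ψ ≠ ⊥ → P ψ → ¬ R ψ →
        ψ.size ≤ χ.size := by
  classical
  have hex' : ∃ D : ℕ, ∃ χ : Weight σ, highestWeightSpace (orbitCoordRep f n) χ ≠ ⊥ ∧ P χ ∧ ¬ R χ ∧
      (-χ.size).toNat = D := by
    obtain ⟨χ, hχ, hP, hR⟩ := hex
    exact ⟨_, χ, hχ, hP, hR, rfl⟩
  obtain ⟨χ, hχ, hP, hR, hD⟩ := Nat.find_spec hex'
  refine ⟨χ, hχ, hP, hR, fun ψ hψ hPψ hRψ => ?_⟩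
  have hle : Nat.find hex' ≤ (-ψ.size).toNat := Nat.find_min' hex' ⟨ψ, hψ, hPψ, hRψ, rfl⟩
  rw [← hD] at hle
  have hχs := size_nonpos_of_occurs f n hχ
  have hψs := size_nonpos_of_occurs f n hψ
  have h1 : ((-χ.size).toNat : ℤ) = -χ.size := Int.toNat_of_nonneg (by omega)
  have h2 : ((-ψ.size).toNat : ℤ) = -ψ.size := Int.toNat_of_nonneg (by omega)
  have hle' : ((-χ.size).toNat : ℤ) ≤ ((-ψ.size).toNat : ℤ) := by exact_mod_cast hle
  omega

/-- **Every populated face layer of the occurrence monoid starts with an atom** (existence form of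
`atom_of_minDegree_layer`): with `P` facial and `R` additive on the face, if some occurring weight
has `P ∧ ¬R` then there is an occurring ATOM `χ` with `P ∧ ¬R`, of least degree in the layer.
[folklore] -/
theorem exists_atom_of_layer (f : MvPolynomial σ ℂ) (n : ℕ) (P R : Weight σ → Prop)
    (hface : ∀ χ₁ χ₂ : Weight σ, highestWeightSpace (orbitCoordRep f n) χ₁ ≠ ⊥ →
      highestWeightSpace (orbitCoordRep f n) χ₂ ≠ ⊥ → P (χ₁ + χ₂) → P χ₁ ∧ P χ₂)
    (hadd : ∀ χ₁ χ₂ : Weight σ, highestWeightSpace (orbitCoordRep f n) χ₁ ≠ ⊥ →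
      highestWeightSpace (orbitCoordRep f n) χ₂ ≠ ⊥ → P χ₁ → P χ₂ → R χ₁ → R χ₂ → R (χ₁ + χ₂))
    (hex : ∃ χ : Weight σ, highestWeightSpace (orbitCoordRep f n) χ ≠ ⊥ ∧ P χ ∧ ¬ R χ) :
    ∃ χ : Weight σ, highestWeightSpace (orbitCoordRep f n) χ ≠ ⊥ ∧ P χ ∧ ¬ R χ ∧
      (∀ ψ : Weight σ, highestWeightSpace (orbitCoordRep f n) ψ ≠ ⊥ → P ψ → ¬ R ψ →
        ψ.size ≤ χ.size) ∧
      (∀ χ₁ χ₂ : Weight σ, χ₁ + χ₂ = χ → χ₁ ≠ 0 → χ₂ ≠ 0 →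
        highestWeightSpace (orbitCoordRep f n) χ₁ = ⊥ ∨
          highestWeightSpace (orbitCoordRep f n) χ₂ = ⊥) := by
  obtain ⟨χ, hχ, hP, hR, hmin⟩ := exists_minDegree_of_layer f n P R hex
  exact ⟨χ, hχ, hP, hR, hmin, atom_of_minDegree_layer f n P R hface hadd hP hR hmin⟩

end Layer

/-! ### 3. Block patterns: the faces of the dominant chamber -/

section Blocks

variable {σ : Type*} [Fintype σ] [LinearOrder σ] {β : Type*}

omit [Fintype σ] in
/-- **Block patterns are facial for dominant weights.** If `χ` and `ψ` are dominant (antitone on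
the linearly ordered index type) and `χ + ψ` is constant on every block of a labelling
`κ : σ → β`, then `χ` is constant on every block: for comparable `a ≤ b` in one block,
`χ b ≤ χ a`, `ψ b ≤ ψ a` and `χ a + ψ a = χ b + ψ b`. (Generalises
`…RectangularAtom.apply_eq_apply_of_isDominant_add_eq_const`, the one-block case.) [folklore] -/
theorem isBlockConstant_of_isDominant_add (κ : σ → β) {χ ψ : Weight σ} (hχ : χ.IsDominant)
    (hψ : ψ.IsDominant) (h : ∀ a b : σ, κ a = κ b → (χ + ψ) a = (χ + ψ) b) :
    ∀ a b : σ, κ a = κ b → χ a = χ b := by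
  have key : ∀ x y : σ, x ≤ y → κ x = κ y → χ x = χ y := by
    intro x y hxy hκ
    have h1 : χ y ≤ χ x := hχ hxy
    have h2 : ψ y ≤ ψ x := hψ hxy
    have h3 := h x y hκ
    simp only [Pi.add_apply] at h3
    omega
  intro a b hab
  rcases le_total a b with hle | hle
  · exact key a b hle hab
  · exact (key b a hle hab.symm).symm

/-- Block-constancy for a labelling is FACIAL for the occurrence monoid of `ℂ[Δ_n[f]]`
(occurring weights are dominant, `isDominant_of_hasHighestWeight_orbitCoordRep`). [folklore] -/
theorem isBlockConstant_face (f : MvPolynomial σ ℂ) (n : ℕ) (κ : σ → β) :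
    ∀ χ₁ χ₂ : Weight σ, highestWeightSpace (orbitCoordRep f n) χ₁ ≠ ⊥ →
      highestWeightSpace (orbitCoordRep f n) χ₂ ≠ ⊥ →
      (∀ a b : σ, κ a = κ b → (χ₁ + χ₂) a = (χ₁ + χ₂) b) →
      (∀ a b : σ, κ a = κ b → χ₁ a = χ₁ b) ∧ (∀ a b : σ, κ a = κ b → χ₂ a = χ₂ b) := by
  haveI : Infinite ℂ := CharZero.infinite ℂ
  intro χ₁ χ₂ h1 h2 h
  have hd1 := isDominant_of_hasHighestWeight_orbitCoordRep f
    (show HasHighestWeight (orbitCoordRep f n) χ₁ from h1)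
  have hd2 := isDominant_of_hasHighestWeight_orbitCoordRep f
    (show HasHighestWeight (orbitCoordRep f n) χ₂ from h2)
  refine ⟨isBlockConstant_of_isDominant_add κ hd1 hd2 h, isBlockConstant_of_isDominant_add κ hd2 hd1 ?_⟩
  intro a b hab
  rw [add_comm]
  exact h a b hab

omit [Fintype σ] [LinearOrder σ] in
/-- Constant weights are closed under addition (the one-block sub-face). [folklore] -/
theorem isConstant_add {χ ψ : Weight σ} (hχ : ∀ a b : σ, χ a = χ b) (hψ : ∀ a b : σ, ψ a = ψ b) :
    ∀ a b : σ, (χ + ψ) a = (χ + ψ) b := by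
  intro a b
  simp only [Pi.add_apply, hχ a b, hψ a b]

/-- **Block layers start with an atom.** For ANY labelling `κ : σ → β` of the indices: if some
weight occurring in `ℂ[Δ_n[f]]` is constant on every block of `κ` but not constant, then the
least-degree such weight exists and is an ATOM of the occurrence monoid (block-constancy is facial,
constancy is additive; `exists_atom_of_layer`). For interval labellings these layers are the faces
of the dominant chamber met by `S(f)`, peeled off their constant edge. [folklore] -/
theorem exists_atom_of_blockLayer (f : MvPolynomial σ ℂ) (n : ℕ) (κ : σ → β)
    (hex : ∃ χ : Weight σ, highestWeightSpace (orbitCoordRep f n) χ ≠ ⊥ ∧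
      (∀ a b : σ, κ a = κ b → χ a = χ b) ∧ ¬ (∀ a b : σ, χ a = χ b)) :
    ∃ χ : Weight σ, highestWeightSpace (orbitCoordRep f n) χ ≠ ⊥ ∧
      (∀ a b : σ, κ a = κ b → χ a = χ b) ∧ ¬ (∀ a b : σ, χ a = χ b) ∧
      (∀ ψ : Weight σ, highestWeightSpace (orbitCoordRep f n) ψ ≠ ⊥ →
        (∀ a b : σ, κ a = κ b → ψ a = ψ b) → ¬ (∀ a b : σ, ψ a = ψ b) → ψ.size ≤ χ.size) ∧
      (∀ χ₁ χ₂ : Weight σ, χ₁ + χ₂ = χ → χ₁ ≠ 0 → χ₂ ≠ 0 →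
        highestWeightSpace (orbitCoordRep f n) χ₁ = ⊥ ∨
          highestWeightSpace (orbitCoordRep f n) χ₂ = ⊥) :=
  exists_atom_of_layer f n (fun χ => ∀ a b : σ, κ a = κ b → χ a = χ b)
    (fun χ => ∀ a b : σ, χ a = χ b) (isBlockConstant_face f n κ)
    (fun _ _ _ _ _ _ hR1 hR2 => isConstant_add hR1 hR2) hex

/-- **The least-degree non-constant occurring weight is an atom** (the finest labelling: every
block a singleton, so every weight is block-constant). [folklore] -/
theorem exists_atom_minDegree_nonconstant (f : MvPolynomial σ ℂ) (n : ℕ)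
    (hex : ∃ χ : Weight σ, highestWeightSpace (orbitCoordRep f n) χ ≠ ⊥ ∧ ¬ (∀ a b : σ, χ a = χ b)) :
    ∃ χ : Weight σ, highestWeightSpace (orbitCoordRep f n) χ ≠ ⊥ ∧ ¬ (∀ a b : σ, χ a = χ b) ∧
      (∀ ψ : Weight σ, highestWeightSpace (orbitCoordRep f n) ψ ≠ ⊥ → ¬ (∀ a b : σ, ψ a = ψ b) →
        ψ.size ≤ χ.size) ∧
      (∀ χ₁ χ₂ : Weight σ, χ₁ + χ₂ = χ → χ₁ ≠ 0 → χ₂ ≠ 0 →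
        highestWeightSpace (orbitCoordRep f n) χ₁ = ⊥ ∨
          highestWeightSpace (orbitCoordRep f n) χ₂ = ⊥) := by
  obtain ⟨χ, hχ, hnc⟩ := hex
  obtain ⟨χ', hχ', -, hnc', hmin, hatom⟩ :=
    exists_atom_of_blockLayer f n (fun a : σ => a) ⟨χ, hχ, fun a b hab => by rw [hab], hnc⟩
  exact ⟨χ', hχ', hnc', fun ψ hψ hψnc => hmin ψ hψ (fun a b hab => by rw [hab]) hψnc, hatom⟩

end Blocks

/-! ### 4. The permanent: two-block (fattened rectangular) layers and `stub_atomLate` -/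

variable {m : ℕ}

/-- **Fattened rectangular layers of `S(per_m)` start with an atom.** Fix a cut `p : MatIdx m`
and call a weight TWO-BLOCK at `p` if it is constant on `{a ≤ p}` and on `{a > p}` (block pattern
of the labelling `a ↦ (a ≤ p)`); the occurring two-block weights are the constant weights
`-t·𝟙` together with the fattened rectangles `-(t·𝟙 + k·𝟙_{a > p})`, `k ≥ 1` — the span of the
constant ray and the chamber ray `(k^{#{a > p}})^*`-direction of `…RectangularRays` (its `t = 0`
edge). If some NON-constant two-block weight occurs in `ℂ[Δ_m[per_m]]`, the least-degree one is
an ATOM of `S(per_m)` (`exists_atom_of_blockLayer`), whether or not the pure ray is hit.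
[folklore] -/
theorem per_exists_atom_of_fatLayer (p : MatIdx m)
    (hex : ∃ χ : Weight (MatIdx m),
      highestWeightSpace (orbitCoordRep (MvPolynomial.rename toLex (perPoly (Fin m) ℂ)) m) χ ≠ ⊥ ∧
      (∀ a b : MatIdx m, (a ≤ p ↔ b ≤ p) → χ a = χ b) ∧ ¬ (∀ a b : MatIdx m, χ a = χ b)) :
    ∃ χ : Weight (MatIdx m),
      highestWeightSpace (orbitCoordRep (MvPolynomial.rename toLex (perPoly (Fin m) ℂ)) m) χ ≠ ⊥ ∧
      (∀ a b : MatIdx m, (a ≤ p ↔ b ≤ p) → χ a = χ b) ∧ ¬ (∀ a b : MatIdx m, χ a = χ b) ∧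
      (∀ ψ : Weight (MatIdx m),
        highestWeightSpace (orbitCoordRep (MvPolynomial.rename toLex (perPoly (Fin m) ℂ)) m) ψ ≠ ⊥ →
        (∀ a b : MatIdx m, (a ≤ p ↔ b ≤ p) → ψ a = ψ b) → ¬ (∀ a b : MatIdx m, ψ a = ψ b) →
          ψ.size ≤ χ.size) ∧
      (∀ χ₁ χ₂ : Weight (MatIdx m), χ₁ + χ₂ = χ → χ₁ ≠ 0 → χ₂ ≠ 0 →
        highestWeightSpace (orbitCoordRep (MvPolynomial.rename toLex (perPoly (Fin m) ℂ)) m) χ₁ = ⊥ ∨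
          highestWeightSpace (orbitCoordRep (MvPolynomial.rename toLex (perPoly (Fin m) ℂ)) m) χ₂ = ⊥) := by
  classical
  have key := exists_atom_of_blockLayer (rename toLex (perPoly (Fin m) ℂ)) m
    (fun a : MatIdx m => decide (a ≤ p))
  simp only [decide_eq_decide] at key
  exact key hex

/-- **Late block layers ⇒ late atoms** (`stub_atomLate` from a late face layer). Suppose that for
every `c, m₀` some `m ≥ max(m₀, 1)` carries a labelling `κ : MatIdx m → ℕ` of the matrix positions
whose block layer of `S(per_m)` is POPULATED (some occurring weight is constant on the blocks of
`κ` but not constant) and LATE (every such weight has degree `-|χ|/m > 2^((log₂ m + c)^c)`). Then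
the registered `stub_atomLate` holds verbatim: the least-degree weight of the layer is an atom
(`exists_atom_of_blockLayer`) and is late by hypothesis. [folklore] -/
theorem stub_atomLate_of_late_blockLayer
    (H : ∀ c m₀ : ℕ, ∃ m : ℕ, m₀ ≤ m ∧ 1 ≤ m ∧ ∃ κ : MatIdx m → ℕ,
      (∃ χ : Weight (MatIdx m),
        highestWeightSpace (orbitCoordRep (MvPolynomial.rename toLex (perPoly (Fin m) ℂ)) m) χ ≠ ⊥ ∧
        (∀ a b : MatIdx m, κ a = κ b → χ a = χ b) ∧ ¬ (∀ a b : MatIdx m, χ a = χ b)) ∧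
      (∀ χ : Weight (MatIdx m),
        highestWeightSpace (orbitCoordRep (MvPolynomial.rename toLex (perPoly (Fin m) ℂ)) m) χ ≠ ⊥ →
        (∀ a b : MatIdx m, κ a = κ b → χ a = χ b) → ¬ (∀ a b : MatIdx m, χ a = χ b) →
          (m : ℤ) * 2 ^ ((Nat.log 2 m + c) ^ c) < -(Weight.size χ))) :
    ∀ c m₀ : ℕ, ∃ m : ℕ, m₀ ≤ m ∧ 1 ≤ m ∧ ∃ χ : Weight (MatIdx m),
      highestWeightSpace (orbitCoordRep (MvPolynomial.rename toLex (perPoly (Fin m) ℂ)) m) χ ≠ ⊥ ∧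
      (∀ χ₁ χ₂ : Weight (MatIdx m), χ₁ + χ₂ = χ → χ₁ ≠ 0 → χ₂ ≠ 0 →
          highestWeightSpace (orbitCoordRep (MvPolynomial.rename toLex (perPoly (Fin m) ℂ)) m) χ₁ = ⊥ ∨
            highestWeightSpace (orbitCoordRep (MvPolynomial.rename toLex (perPoly (Fin m) ℂ)) m) χ₂ = ⊥) ∧
      (m : ℤ) * 2 ^ ((Nat.log 2 m + c) ^ c) < -(Weight.size χ) := by
  intro c m₀
  obtain ⟨m, hm₀, hm, κ, hex, hlate⟩ := H c m₀
  obtain ⟨χ, hχ, hblock, hnc, -, hatom⟩ :=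
    exists_atom_of_blockLayer (rename toLex (perPoly (Fin m) ℂ)) m κ hex
  exact ⟨m, hm₀, hm, χ, hχ, hatom, hlate χ hχ hblock hnc⟩

/-- **Late fattened rectangular layers ⇒ late atoms** (two-block instance of
`stub_atomLate_of_late_blockLayer`, generalising `…RectangularRays.stub_atomLate_of_late_rectangle`
from the pure chamber rays to their two-dimensional faces): if for every `c, m₀` some
`m ≥ max(m₀, 1)` has a cut `p : MatIdx m` such that some non-constant occurring weight of
`ℂ[Δ_m[per_m]]` is constant on `{a ≤ p}` and on `{a > p}`, and every such weight has degree
`> 2^((log₂ m + c)^c)`, then `stub_atomLate` holds verbatim. Informally (see the module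
docstring): every such layer IS populated with rectangular part `k ≤ 2m²`, so the hypothesis is a
statement about late FIRST OCCURRENCE in the orbit closure of a polynomial-level orbit type.
[folklore] -/
theorem stub_atomLate_of_late_fatLayer
    (H : ∀ c m₀ : ℕ, ∃ m : ℕ, m₀ ≤ m ∧ 1 ≤ m ∧ ∃ p : MatIdx m,
      (∃ χ : Weight (MatIdx m),
        highestWeightSpace (orbitCoordRep (MvPolynomial.rename toLex (perPoly (Fin m) ℂ)) m) χ ≠ ⊥ ∧
        (∀ a b : MatIdx m, (a ≤ p ↔ b ≤ p) → χ a = χ b) ∧ ¬ (∀ a b : MatIdx m, χ a = χ b)) ∧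
      (∀ χ : Weight (MatIdx m),
        highestWeightSpace (orbitCoordRep (MvPolynomial.rename toLex (perPoly (Fin m) ℂ)) m) χ ≠ ⊥ →
        (∀ a b : MatIdx m, (a ≤ p ↔ b ≤ p) → χ a = χ b) → ¬ (∀ a b : MatIdx m, χ a = χ b) →
          (m : ℤ) * 2 ^ ((Nat.log 2 m + c) ^ c) < -(Weight.size χ))) :
    ∀ c m₀ : ℕ, ∃ m : ℕ, m₀ ≤ m ∧ 1 ≤ m ∧ ∃ χ : Weight (MatIdx m),
      highestWeightSpace (orbitCoordRep (MvPolynomial.rename toLex (perPoly (Fin m) ℂ)) m) χ ≠ ⊥ ∧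
      (∀ χ₁ χ₂ : Weight (MatIdx m), χ₁ + χ₂ = χ → χ₁ ≠ 0 → χ₂ ≠ 0 →
          highestWeightSpace (orbitCoordRep (MvPolynomial.rename toLex (perPoly (Fin m) ℂ)) m) χ₁ = ⊥ ∨
            highestWeightSpace (orbitCoordRep (MvPolynomial.rename toLex (perPoly (Fin m) ℂ)) m) χ₂ = ⊥) ∧
      (m : ℤ) * 2 ^ ((Nat.log 2 m + c) ^ c) < -(Weight.size χ) := by
  intro c m₀
  obtain ⟨m, hm₀, hm, p, hex, hlate⟩ := H c m₀
  obtain ⟨χ, hχ, hblock, hnc, -, hatom⟩ := per_exists_atom_of_fatLayer p hex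
  exact ⟨m, hm₀, hm, χ, hχ, hatom, hlate χ hχ hblock hnc⟩

end Summit.ValiantsHypothesis.ValiantsHypothesis.Theorems.GeneratorObstructions.PerGenDegreeSuperQP

end
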